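import Summits.NavierStokesRegularity.NavierStokesRegularity.Theorems.ScenarioCensusRowD9Modulation
import HarnessLib

/-!
# Census row D9 TYPED — part 2/9: the kernel (§5) — slice energy bound, CORE ⇒ gate, G2 derived, the rung given S0,
# `row_D9LH_of_gates`, `row_D9LH_iff_wild`, the rows from S0 + the steady wall

Re-homed for the scenario census (typer seat ns-census-typer-1 g7; in scope of the census KEY text «one `def Row_<k> : Prop`
per OPEN row» — row D9 was the one OPEN-NO-LINE row without a typed tree decl, typer-1 g6 HANDOFF 19:50Z; lead programme ended
at v1.67, base SUMMON-only; ANNOUNCE on the cell STATUS 2026-08-28T20:24Z): VERBATIM PORT of ns-idea-9 LINE 16 «modulation_gate»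
rev 5, `pub/ideators/ns-idea-9/lines/modulation_gate/modulation_gate.lean` sha16 1d7b2cd493e504e0 (2259 l., lean check rc 0,
0 sorry; critic idea-crit-8 V66/V67/V69 PASS-WITH-PRICE on rev 1–4, ref ns-census-ref g8 PRE-CHECK ✓ §13.14 [5/6] of rev 4
f704279be2039922; rev 5 = rev 4 + §6e «S0 proved»; TARGET-MENU r4 names this line as row D9's lever; CENSUS-FINAL r6 §2 lists
`row_F4bp_of_row_D9K` / `row_F4bpLH_of_row_D9LH` as FILES-ONLY edges), split for the 400-line rule into
`ScenarioCensusRowD9Modulation` (§1–§4) → `…RowD9Kernel` (§5) → `…RowD9PowerLaw` (§6) → `…RowD9CoreExponents` (§6c (i)–(iv)) →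
`…RowD9Core` (§6c (v)) → `…RowD9DissipationTools` (§6d, first half) → `…RowD9Dissipation` (§6d, second half) →
`…RowD9SteadyLimitTools` (§6e, first half) → `…RowD9` (§6e, second half; §7; census KEYS).  Lean text VERBATIM in namespace
`…Theorems.ScenarioCensus.ModulationGate` (the line's `…Cruxes.Row_F4bp.ModulationGate` re-homed); port edits: the two
`local notation "E3"` lines → `abbrev E3` (typer lint: no notation in port files), `@[conjecture]` added to the four OPEN
parameterless `def`s `Row_D9K` / `Row_D9LH` / `Row_D9LHWild` / `Row_F4bpLH` (obligation nodes), one-line docstrings added to twelve undocumented auxiliaries, the three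
`@[deprecated] stub_*` aliases of §7 not re-declared, four §7 docstrings updated to the rev-5 facts (everything proved).

No census value is asserted here (a summoned lead books row D9; FILES-ONLY edges become TREE by name); NS regularity is NOT
proved; rows D9 / F4b′ stay OPEN (= their wild residuals, by theorem); no summit statement is proved by this file.
-/

-- the summit and its single problem share the name `NavierStokesRegularity` (D-0017 nested layout)
set_option linter.dupNamespace false

noncomputable section

open Set Function Filter Topology MeasureTheory Metric
open scoped NNReal ENNReal ContDiff

namespace Summit.NavierStokesRegularity.NavierStokesRegularity.Theorems.ScenarioCensus.ModulationGate

open Literature.Analysis Literature.Analysis.FluidPDE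
open Summit.NavierStokesRegularity.NavierStokesRegularity.Theorems.ScenarioCensus

/-! ## §5 Kernel (sorry-free) -/

/-- `9/2 < p` gives `3 < p` (in `ℝ≥0∞`). -/
theorem three_lt_of_nineHalves_lt {p : ℝ≥0} (hp : (9 / 2 : ℝ≥0∞) < (p : ℝ≥0∞)) :
    (3 : ℝ≥0∞) < (p : ℝ≥0∞) :=
  lt_trans three_lt_nineHalves_ennreal hp

/-- `3 < p` gives `2 ≤ p` (in `ℝ≥0`). -/
theorem two_le_of_three_lt {p : ℝ≥0} (hp : (3 : ℝ≥0∞) < (p : ℝ≥0∞)) : 2 ≤ p := by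
  have h3 : (3 : ℝ≥0) < p := by exact_mod_cast hp
  exact le_trans (by norm_num) h3.le

/-- **Energy bound of the slices** (support, PROVED): for a Leray–Hopf solution with no force,
`‖v(t)‖_{L²} ≤ ‖v(0)‖_{L²}` for every `t ∈ [0,T]`. [cite: RobinsonRodrigoSadowski2016, Def. 4.9] -/
theorem lh_eLpNorm_two_le {T : ℝ}
    {v : ℝ → EuclideanSpace ℝ (Fin 3) → EuclideanSpace ℝ (Fin 3)}
    (hLH : IsLerayHopfOn T 1 0 (v 0) v) {t : ℝ} (ht : t ∈ Icc 0 T) :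
    eLpNorm (v t) 2 volume ≤ eLpNorm (v 0) 2 volume := by
  have hT : 0 ≤ T := le_trans ht.1 ht.2
  have hK := hLH.kineticEnergy_le_of_zero_force zero_le_one ht
  have hmt : MemLp (v t) 2 volume := hLH.memLp t ht
  have hm0 : MemLp (v 0) 2 volume := hLH.memLp 0 ⟨le_rfl, hT⟩
  rw [kineticEnergy_eq_half_toReal_eLpNorm_sq hmt, kineticEnergy_eq_half_toReal_eLpNorm_sq hm0] at hK
  have ha : 0 ≤ (eLpNorm (v t) 2 volume).toReal := ENNReal.toReal_nonneg
  have hb : 0 ≤ (eLpNorm (v 0) 2 volume).toReal := ENNReal.toReal_nonneg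
  have hab : (eLpNorm (v t) 2 volume).toReal ≤ (eLpNorm (v 0) 2 volume).toReal := by
    nlinarith
  exact (ENNReal.toReal_le_toReal hmt.eLpNorm_ne_top hm0.eLpNorm_ne_top).1 hab

/-- **Pointwise CORE ⇒ gate** (the common engine of G2 here and of LINE 15's `RateGate`): a Leray–Hopf
solution, ANY `λ(t) → ∞` (only divergence is used — no stationarity), an `L^p` profile (`p > 3`) whose
a.e.-representative is a smooth steady solution, and a tame remainder along a sequence
(`liminf λ^{−3/(2p)}‖v(t) − λV̄(λ·)‖_p = 0`) force `V̄ = 0` a.e.  PROVED from the CORE + the LH slice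
energy bound. -/
theorem ae_eq_zero_of_core (hC : SteadyZoomDistance) {T : ℝ} (hT : 0 < T) {p : ℝ≥0}
    (hp3 : (3 : ℝ≥0) < p) {v : ℝ → EuclideanSpace ℝ (Fin 3) → EuclideanSpace ℝ (Fin 3)}
    (hLH : IsLerayHopfOn T 1 0 (v 0) v) {lam : ℝ → ℝ} (hlam : Tendsto lam (𝓝[<] T) atTop)
    {V U : EuclideanSpace ℝ (Fin 3) → EuclideanSpace ℝ (Fin 3)} {P : EuclideanSpace ℝ (Fin 3) → ℝ}
    (hV : MemLp V (p : ℝ≥0∞) volume) (hUP : IsSteadyClassicalNS 1 0 U P) (hVU : V =ᵐ[volume] U)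
    (hlim : liminf (zoomGateQuantity lam p v V) (𝓝[<] T) = 0) : V =ᵐ[volume] 0 := by
  by_cases hU : U = 0
  · rw [hU] at hVU; exact hVU
  · exfalso
    have hMfin : eLpNorm (v 0) 2 volume ≠ ⊤ := (hLH.memLp 0 ⟨le_rfl, hT.le⟩).eLpNorm_ne_top
    obtain ⟨c, hc0, hcore⟩ := hC U V P hUP hVU p hp3 hV hU (eLpNorm (v 0) 2 volume) hMfin
    have hev1 : ∀ᶠ t in 𝓝[<] T, ∀ (w : EuclideanSpace ℝ (Fin 3) → EuclideanSpace ℝ (Fin 3)),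
        AEStronglyMeasurable w volume → eLpNorm w 2 volume ≤ eLpNorm (v 0) 2 volume →
          c ≤ ENNReal.ofReal ((lam t) ^ (-(3 / (2 * (p : ℝ))))) *
            eLpNorm (fun x => w x - lam t • V (lam t • x)) (p : ℝ≥0∞) volume :=
      hlam.eventually hcore
    have hev2 : ∀ᶠ t in 𝓝[<] T, t ∈ Ico 0 T := by
      have h1 : ∀ᶠ t in 𝓝[<] T, t < T := eventually_nhdsWithin_of_forall fun t ht => ht
      have h2 : ∀ᶠ t in 𝓝[<] T, 0 ≤ t :=
        eventually_nhdsWithin_of_eventually_nhds ((eventually_gt_nhds hT).mono fun t ht => ht.le)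
      filter_upwards [h1, h2] with t h1 h2
      exact ⟨h2, h1⟩
    have hlt : liminf (zoomGateQuantity lam p v V) (𝓝[<] T) < c := by
      rw [hlim]
      exact pos_iff_ne_zero.2 hc0
    have hfreq : ∃ᶠ t in 𝓝[<] T, zoomGateQuantity lam p v V t < c :=
      frequently_lt_of_liminf_lt (h := hlt)
    obtain ⟨t, ht, h1, h2⟩ := (hfreq.and_eventually (hev1.and hev2)).exists
    have hle := h1 (v t) (hLH.memLp t ⟨h2.1, h2.2.le⟩).aestronglyMeasurable
      (lh_eLpNorm_two_le hLH ⟨h2.1, h2.2.le⟩)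
    exact absurd hle (not_le.2 ht)

/-- **G2 DERIVED**: S0 + CORE ⇒ the modulated rate gate.  PROVED. -/
theorem modulatedRateGate_of_core (hS0 : ModulatedSteadyLimit) (hC : SteadyZoomDistance) :
    ModulatedRateGate := by
  intro T hT p hp v π hv hLH lam hmod V hV hdev hlim
  have hp3 : (3 : ℝ≥0) < p := by exact_mod_cast hp
  obtain ⟨U, P, hUP, hVU⟩ := hS0 T hT p hp3 v π
    (hv.mono Ioo_subset_Ico_self (uniqueDiffOn_Ioo 0 T)) lam hmod V hV hdev
  exact ae_eq_zero_of_core hC hT hp3 hLH hmod.tendsto_atTop hV hUP hVU hlim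

/-- **RUNG given S0 (any frame, no `Ḣ¹`)**: for `3 < p ≤ 9/2` a modulated asymptotically
self-similar profile vanishes, by S0 and the no-Dirichlet `L^q` Liouville lemma. -/
def Row_D9Sharp : Prop :=
  ∀ (T : ℝ), 0 < T → ∀ (p : ℝ≥0), 3 < p → (p : ℝ≥0∞) ≤ 9 / 2 →
    ∀ (v : ℝ → EuclideanSpace ℝ (Fin 3) → EuclideanSpace ℝ (Fin 3))
      (π : ℝ → EuclideanSpace ℝ (Fin 3) → ℝ),
    IsClassicalNSSolutionOn (Ioo 0 T) 1 0 v π →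
    ∀ (lam : ℝ → ℝ), IsStationaryModulation T lam →
    ∀ (V : EuclideanSpace ℝ (Fin 3) → EuclideanSpace ℝ (Fin 3)),
    MemLp V (p : ℝ≥0∞) volume → Tendsto (modulatedDeviation lam p v V) (𝓝[<] T) (𝓝 0) →
    V =ᵐ[volume] 0

/-- **The rung given S0**: `ModulatedSteadyLimit → Row_D9Sharp` (S0, then the no-Dirichlet `L^q` Liouville lemma). -/
theorem row_D9Sharp_of_S0 (hS0 : ModulatedSteadyLimit) : Row_D9Sharp := by
  intro T hT p hp3 hp92 v π hv lam hmod V hV hdev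
  obtain ⟨U, P, hUP, hVU⟩ := hS0 T hT p hp3 v π hv lam hmod V hV hdev
  have hUq : MemLp U (p : ℝ≥0∞) volume := hV.ae_eq hVU
  have hU0 : U = 0 := steady_eq_zero_of_memLp_superThree hUP hp3 hp92 hUq
  rw [hU0] at hVU
  exact hVU

/-- **KERNEL.** S0 + CORE (hence G2) + G1 + the wild residual close row D9 in the LH frame: for
`3 < p ≤ 9/2` the rung; for `p > 9/2` split on the integrability of `λ` near `T` (non-integrable: G1),
then on `liminf` of the zoom-gate quantity (`= 0`: G2; `≠ 0`: the residual). -/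
theorem row_D9LH_of_gates (hS0 : ModulatedSteadyLimit) (hC : SteadyZoomDistance)
    (hG1 : ModulatedDissipationGate) (hW : Row_D9LHWild) : Row_D9LH := by
  intro T hT p hp v π hv hLH lam hmod V hV hdev hH1
  have hp3 : (3 : ℝ≥0) < p := by exact_mod_cast hp
  rcases le_or_gt (p : ℝ≥0∞) (9 / 2) with hp92 | hp92
  · exact row_D9Sharp_of_S0 hS0 T hT p hp3 hp92 v π
      (hv.mono Ioo_subset_Ico_self (uniqueDiffOn_Ioo 0 T)) lam hmod V hV hdev
  · by_cases hint : ∃ ε : ℝ, 0 < ε ∧ ε < T ∧ ∫⁻ t in Ioo (T - ε) T, ENNReal.ofReal (lam t) < ⊤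
    · rcases eq_or_ne (liminf (zoomGateQuantity lam p v V) (𝓝[<] T)) 0 with h0 | h0
      · exact modulatedRateGate_of_core hS0 hC T hT p hp v π hv hLH lam hmod V hV hdev h0
      · exact hW T hT p hp92 v π hv hLH lam hmod hint V hV hdev h0 hH1
    · have hdiv : ∀ ε : ℝ, 0 < ε → ε < T → ∫⁻ t in Ioo (T - ε) T, ENNReal.ofReal (lam t) = ⊤ := by
        intro ε hε hεT
        by_contra hne
        exact hint ⟨ε, hε, hεT, lt_top_iff_ne_top.2 hne⟩
      exact hG1 T hT p (two_le_of_three_lt hp) v π hv hLH lam hmod hdiv V hV hdev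

/-- The residual is a sub-cell of the row (wuc direction). -/
theorem row_D9LHWild_of_row_D9LH (h : Row_D9LH) : Row_D9LHWild :=
  fun T hT p hp v π hv hLH lam hmod _ V hV hdev _ hH1 =>
    h T hT p (three_lt_of_nineHalves_lt hp) v π hv hLH lam hmod V hV hdev hH1

/-- **Row D9 (LH frame) ⟺ its wild residual**, given S0, the CORE and G1. -/
theorem row_D9LH_iff_wild (hS0 : ModulatedSteadyLimit) (hC : SteadyZoomDistance)
    (hG1 : ModulatedDissipationGate) : Row_D9LH ↔ Row_D9LHWild :=
  ⟨row_D9LHWild_of_row_D9LH, row_D9LH_of_gates hS0 hC hG1⟩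

/-- **The Kato-frame row from S0 and the steady wall** `∀ q > 9/2, Row_F4bpSteady q` (and the rung
below `9/2`): Chae's printed argument for a general stationary modulation. -/
theorem row_D9K_of_S0_of_steady (hS0 : ModulatedSteadyLimit)
    (hS : ∀ q : ℝ≥0, (9 / 2 : ℝ≥0∞) < (q : ℝ≥0∞) → Row_F4bpSteady q) : Row_D9K := by
  intro T hT p hp v π hv _hK lam hmod V hV hdev hH1
  have hp3 : (3 : ℝ≥0) < p := by exact_mod_cast hp
  have hp1 : (1 : ℝ≥0) ≤ p := le_trans (by norm_num) hp3.le
  obtain ⟨U, P, hUP, hVU⟩ := hS0 T hT p hp3 v π hv lam hmod V hV hdev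
  have hUp : MemLp U (p : ℝ≥0∞) volume := hV.ae_eq hVU
  rcases le_or_gt (p : ℝ≥0∞) (9 / 2) with hp92 | hp92
  · have hU0 : U = 0 := steady_eq_zero_of_memLp_superThree hUP hp3 hp92 hUp
    rw [hU0] at hVU; exact hVU
  · have hprof : IsLerayProfile 1 0 U P := hUP.isLerayProfile_zero
    have hU1 : ContDiff ℝ 1 U := hUP.smooth_velocity.of_le (by norm_cast)
    obtain ⟨G, hG⟩ := iInf_lt_iff.1 hH1
    obtain ⟨hWG, hGlt⟩ := iInf_lt_iff.1 hG
    have hWGU : HasWeakGradient U G := hWG.congr_ae hVU.symm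
    have hDU : HasWeakGradient U (fderiv ℝ U) := hasWeakGradient_fderiv_of_contDiff hU1
    have haeG : fderiv ℝ U =ᵐ[volume] G := by
      have := FunctionSpaces.HasWeakFDerivOn.unique_holds hDU hWGU
      simpa [Measure.restrict_univ] using this
    have hD : (∫⁻ x, ENNReal.ofReal (frobeniusNormSq (fderiv ℝ U x))) < ⊤ := by
      have e : (∫⁻ x, ENNReal.ofReal (frobeniusNormSq (fderiv ℝ U x))) =
          ∫⁻ x, ENNReal.ofReal (frobeniusNormSq (G x)) := by
        refine lintegral_congr_ae ?_
        filter_upwards [haeG] with x hx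
        rw [hx]
      rw [e]; exact hGlt
    have hU0 : U = 0 := hS p hp92 hp1 U P hprof hUP.smooth_velocity hUP.smooth_pressure hD hUp
    rw [hU0] at hVU
    exact hVU

/-- The LH-frame row from S0 and the wall (the LH binder is not used). -/
theorem row_D9LH_of_S0_of_steady (hS0 : ModulatedSteadyLimit)
    (hS : ∀ q : ℝ≥0, (9 / 2 : ℝ≥0∞) < (q : ℝ≥0∞) → Row_F4bpSteady q) : Row_D9LH := by
  intro T hT p hp v π hv hLH lam hmod V hV hdev hH1
  -- a classical LH solution on `[0,T)` is Kato-class?  Not needed: rerun the Kato-frame proof, whose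
  -- Kato binder is unused, on the restricted classical solution.
  have hv' : IsClassicalNSSolutionOn (Ioo 0 T) 1 0 v π :=
    hv.mono Ioo_subset_Ico_self (uniqueDiffOn_Ioo 0 T)
  have hp3 : (3 : ℝ≥0) < p := by exact_mod_cast hp
  have hp1 : (1 : ℝ≥0) ≤ p := le_trans (by norm_num) hp3.le
  obtain ⟨U, P, hUP, hVU⟩ := hS0 T hT p hp3 v π hv' lam hmod V hV hdev
  have hUp : MemLp U (p : ℝ≥0∞) volume := hV.ae_eq hVU
  rcases le_or_gt (p : ℝ≥0∞) (9 / 2) with hp92 | hp92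
  · have hU0 : U = 0 := steady_eq_zero_of_memLp_superThree hUP hp3 hp92 hUp
    rw [hU0] at hVU; exact hVU
  · have hprof : IsLerayProfile 1 0 U P := hUP.isLerayProfile_zero
    have hU1 : ContDiff ℝ 1 U := hUP.smooth_velocity.of_le (by norm_cast)
    obtain ⟨G, hG⟩ := iInf_lt_iff.1 hH1
    obtain ⟨hWG, hGlt⟩ := iInf_lt_iff.1 hG
    have hWGU : HasWeakGradient U G := hWG.congr_ae hVU.symm
    have hDU : HasWeakGradient U (fderiv ℝ U) := hasWeakGradient_fderiv_of_contDiff hU1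
    have haeG : fderiv ℝ U =ᵐ[volume] G := by
      have := FunctionSpaces.HasWeakFDerivOn.unique_holds hDU hWGU
      simpa [Measure.restrict_univ] using this
    have hD : (∫⁻ x, ENNReal.ofReal (frobeniusNormSq (fderiv ℝ U x))) < ⊤ := by
      have e : (∫⁻ x, ENNReal.ofReal (frobeniusNormSq (fderiv ℝ U x))) =
          ∫⁻ x, ENNReal.ofReal (frobeniusNormSq (G x)) := by
        refine lintegral_congr_ae ?_
        filter_upwards [haeG] with x hx
        rw [hx]
      rw [e]; exact hGlt
    have hU0 : U = 0 := hS p hp92 hp1 U P hprof hUP.smooth_velocity hUP.smooth_pressure hD hUp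
    rw [hU0] at hVU
    exact hVU

/-- **The residual is weaker than S0 + the wall.** -/
theorem row_D9LHWild_of_S0_of_steady (hS0 : ModulatedSteadyLimit)
    (hS : ∀ q : ℝ≥0, (9 / 2 : ℝ≥0∞) < (q : ℝ≥0∞) → Row_F4bpSteady q) : Row_D9LHWild :=
  row_D9LHWild_of_row_D9LH (row_D9LH_of_S0_of_steady hS0 hS)

end Summit.NavierStokesRegularity.NavierStokesRegularity.Theorems.ScenarioCensus.ModulationGate

end
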